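import Literature.MathematicalPhysics.QuantumFieldTheory.Balaban1983to89.B4Prop23RegularFamily
import Literature.MathematicalPhysics.QuantumFieldTheory.Balaban1983to89.B4Eq12ExpFlow

/-!
# `Balaban1983to89.B4Prop23RegularFamilyLit` — T. Bałaban, *Regularity and decay of lattice Green's functions*, Commun.
# Math. Phys. **89** (1983) 571–597 [Balaban1983RegularityDecay] (= B4): «Proposition 2.3 of [1]» (1.15)–(1.20) p. 574 on
# the regular-field family (`A ≠ 0`) WITH THE LITERAL COMPLEMENTS `Λ^c = Z^d ∖ Λ`, `Ω^{(k)c} = Z^d ∖ Ω^{(k)}` and `Λ` a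
# set of SITES

statement-level skeleton of published theorems with citation tags; proofs where landed; nothing here is a claim about the Yang–Mills mass gap

PDF held: `paper:balaban1983-cmp89-regularity-decay` (journal page = PDF page + 570); p. 574 [PDF 4] read on the ×2 render
`…/b2b-balaban-ref1/pages/1983-cmp89-regularity-decay/…-p004-x2.png`.

CITATION HEADER (lean-in-tree rule).  Cell `lit-balaban` (HOME `run/shared/lean/pub/lit-balaban/`), Phase-2 proof seat
**p17** gen 3 (unit `lit-balaban-p17-g3`), file 6: the literal-complement variant of the leaf `B4Prop23RegularFamily`
(row **B4.Prop2.3[I]**, `B4.Prop23Printed`, owner r01, referee ref-4), in the manner of b04's zero-field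
`B4Prop23ZeroRegion.prop23Printed_zeroFieldRegionsLit` (whose `dCompl`, `dCompl_le_distCS`, `dCompl_le_dSet`,
`exp_bound_mono_weight` are reused).

WHAT IS PRINTED (p. 574 [PDF 4], verbatim): *"for arbitrary Λ ⊂ Ω^{(k)} = Ω∩Z^d … |δC^{(k)}_Λ(Ω,A; x,x′)| ≤
c₀exp(−δ₀(|x−x′| + dist(x,Λ^c) + dist(x′,Λ^c))), x, x′ ∈ Λ. (1.18) … |δC^{(k)}_Λ(Ω,Ω₀,A; x,x′)| ≤ c₀exp(−δ₀(|x−x′| +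
dist(x,Ω^{(k)c}) + dist(x′,Ω^{(k)c}))), x, x′ ∈ Λ. (1.20)"*.

THE FAMILY (`RegularRegionIdxLit`, `regularFieldRegionsLit`): as `B4Prop23RegularFamily.regularFieldRegions`, but the
index carries a set `Λ` OF SITES of `Ω^{(k)}` (the printed `Λ ⊂ Ω^{(k)}`; the site–colour set is `Λ × {colours}`), and
`distLc x = dist_∞(x, Z^d ∖ Λ)` (`dCompl (Subtype.val '' ↑Λ)`), `distOc x = dist_∞(x, Z^d ∖ Ω^{(k)})` (`dCompl ↑Ω^{(k)}`) —
the complements of (1.18), (1.20) taken literally in the unit lattice `Z^{d+1}`.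

WHAT IS KERNEL-CHECKED (zero `sorry`, standard axioms; no `Prop`-valued definition): the re-indexing lemmas `cLam_reindex`,
`cLam_of_forall_mem` (degenerate `Λ = Ω^{(k)}`: `δC^{(k)}_Λ(Ω,A) = 0`), `cLam_ambient_self` (degenerate `Ω₀ = Ω`:
`δC^{(k)}_Λ(Ω,Ω₀,A) = 0`, by re-indexing — no analytic input), `distCS_le_distCY`, and
**`prop23Printed_regularRegionsLit : B4.Prop23Printed (regularFieldRegionsLit F hL a a′ c β m²₊)`** with the constants of
`prop23Printed_regularRegions`: (1.15), (1.16) as there; (1.18): if `Λ ≠ Ω^{(k)}` the typed weight `dist(·, (Ω^{(k)} × ι)∖(Λ × ι))`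
dominates the literal `dist(·, Z^d ∖ Λ)` (`dCompl_le_distCS`, `distCS_le_distCY`), else the difference vanishes; (1.20): if
`Ω ≠ Ω₀` the typed `dist(·, Ω₀^{(k)}∖Ω^{(k)})` dominates `dist(·, Z^d ∖ Ω^{(k)})` (`dCompl_le_dSet`), else the difference
vanishes; + `_rot`, B1 corollary `prop23Intended_regularRegionsLit`; §4: the `_exp` instances (flow `e^{tq}` of (1.2), any
antisymmetric `q`, via r01's `B4Eq12ExpFlow.expFlow_lipschitz`) of BOTH leaves (`prop23Printed_regularRegions_exp`,
`prop23Printed_regularRegionsLit_exp`, + B1).  HONEST SCOPE as in `B4Prop23RegularFamily` ((1.7) on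
`Ω₀`; constants `(d, N, L, a_k, a′, c, β, ℓ, m²₊)`, GAPS G-B4-p17-01; rate of (1.20) halved).  Unit `lit-balaban-p17-g3`.
-/

namespace Literature.MathematicalPhysics.QuantumFieldTheory.Balaban1983to89.B4Prop23RegularFamilyLit

open Finset Matrix
open Literature.MathematicalPhysics.QuantumFieldTheory.Balaban1983to89
open Literature.MathematicalPhysics.QuantumFieldTheory.Balaban1983to89.B4GaugeCovariance (OrthFlow)
open Literature.MathematicalPhysics.QuantumFieldTheory.Balaban1983to89.B4Lower18Regular (e1 rot_lipschitz)
open Literature.MathematicalPhysics.QuantumFieldTheory.Balaban1983to89.B4Lower18RegularRegion (base_mem_fineDom)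
open Literature.MathematicalPhysics.QuantumFieldTheory.Balaban1983to89.B4Reflection242 (blk blk_mul)
open Literature.MathematicalPhysics.QuantumFieldTheory.Balaban1983to89.B4Lower18 (fineDom mem_fineDom)
open Literature.MathematicalPhysics.QuantumFieldTheory.Balaban1983to89.B4ContourShift (supNorm)
open Literature.MathematicalPhysics.QuantumFieldTheory.Balaban1983to89.B4TwoRegion120 (dSet)
open Literature.MathematicalPhysics.QuantumFieldTheory.Balaban1983to89.B4RegionCov1518 (rhoS distCS distCS_le distCS_nonneg)
open Literature.MathematicalPhysics.QuantumFieldTheory.Balaban1983to89.B4Sect5Torus (IsPseudoDist)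
open Literature.MathematicalPhysics.QuantumFieldTheory.Balaban1983to89.B4GaussRep36 (pOp cOpLam cLam)
open Literature.MathematicalPhysics.QuantumFieldTheory.Balaban1983to89.B4Prop23ZeroRegion (dCompl dCompl_nonneg
  dCompl_le_distCS dCompl_le_dSet exp_bound_mono_weight)
open Literature.MathematicalPhysics.QuantumFieldTheory.Balaban1983to89.B4Cor23Rep36Bridge (hamR QkR)
open Literature.MathematicalPhysics.QuantumFieldTheory.Balaban1983to89.B4NextAvg52 (nextAvg)
open Literature.MathematicalPhysics.QuantumFieldTheory.Balaban1983to89.B4Prop23RegularRegion (rhoY rhoY_isPseudoDist)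
open Literature.MathematicalPhysics.QuantumFieldTheory.Balaban1983to89.B4Ineq120RegularAmbient (inclι)
open Literature.MathematicalPhysics.QuantumFieldTheory.Balaban1983to89.B4Ineq120RegularRegion (omegaY omegaY_nonneg)
open Literature.MathematicalPhysics.QuantumFieldTheory.Balaban1983to89.B4Eq12ExpFlow (expFlow expFlow_ell_nonneg
  expFlow_lipschitz)
open Literature.MathematicalPhysics.QuantumFieldTheory.Balaban1983to89.B4Prop23RegularFamily (distCY distCY_nonneg embY
  lamEquiv RegularRegionIdx regularFieldRegions prop23Printed_regularRegions prop23Intended_regularRegions)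

noncomputable section

variable {d : ℕ} {ι : Type} [Fintype ι] [DecidableEq ι]

/-! ## §1. Re-indexing lemmas and the degenerate cases `Λ = Ω^{(k)}`, `Ω₀ = Ω` -/

/-- re-indexing `C_Λ` along a bijection `Λ ≃ Λ′` over the identity of the sites: same entries. [cite: Balaban1983RegularityDecay, (1.13) p.573, dictionary] -/
theorem cLam_reindex {X Y Z : Type} [Fintype X] [Fintype Y] [Fintype Z] [DecidableEq X] [DecidableEq Y]
    (H : Matrix X X ℝ) (ak : ℝ) (Qk : Matrix Y X ℝ) (s ℓ w : ℝ) (Q : Matrix Z Y ℝ) (Λ Λ' : Finset Y)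
    (E : ↥Λ ≃ ↥Λ') (hE : ∀ y : Λ, ((E y : ↥Λ') : Y) = (y : Y)) (y y' : Λ) :
    cLam H ak Qk s ℓ w Q Λ' (E y) (E y') = cLam H ak Qk s ℓ w Q Λ y y' := by
  have h : (cOpLam H ak Qk s ℓ w Q Λ').submatrix E E = cOpLam H ak Qk s ℓ w Q Λ := by
    ext p q
    simp only [cOpLam, Matrix.submatrix_apply, hE]
  unfold cLam
  rw [← h, Matrix.inv_submatrix_equiv]
  rfl

/-- **THE DEGENERATE CASE `Λ = Ω^{(k)} × {colours}` OF (1.17): `C^{(k)}_Λ(Ω,A) = C^{(k)}(Ω,A)` entrywise.**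
[cite: Balaban1983RegularityDecay, (1.17) p.574] -/
theorem cLam_of_forall_mem {X Y Z : Type} [Fintype X] [Fintype Y] [Fintype Z] [DecidableEq X] [DecidableEq Y]
    (H : Matrix X X ℝ) (ak : ℝ) (Qk : Matrix Y X ℝ) (s ℓ w : ℝ) (Q : Matrix Z Y ℝ) (Λ : Finset Y)
    (hΛ : ∀ z : Y, z ∈ Λ) (y y' : Λ) :
    cLam H ak Qk s ℓ w Q Λ y y' = (B4GaussRep36.deltaK H ak Qk + (s * ℓ) • pOp w Q)⁻¹ y.1 y'.1 := by
  let E : ↥Λ ≃ Y := Equiv.ofBijective (fun y : ↥Λ => y.1) ⟨fun a b h => Subtype.ext h, fun z => ⟨⟨z, hΛ z⟩, rfl⟩⟩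
  have hE : cOpLam H ak Qk s ℓ w Q Λ = (B4GaussRep36.deltaK H ak Qk + (s * ℓ) • pOp w Q).submatrix E E := rfl
  unfold cLam
  rw [hE, Matrix.inv_submatrix_equiv]
  rfl

/-- **THE DEGENERATE CASE `Ω₀ = Ω` OF (1.19): `C^{(k)}_{ιΛ}(Ω₀,A)(ιy,ιy′) = C^{(k)}_Λ(Ω,A)(y,y′)`** (`ι` is then the identity;
pure re-indexing, no analytic input). [cite: Balaban1983RegularityDecay, (1.19) p.574] -/
theorem cLam_ambient_self (F : OrthFlow ι) (e : ℝ) {n L : ℕ} (hn : 1 ≤ n) (hL : 1 ≤ L) (a m2 s w : ℝ)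
    {Zc Z₀c : Finset (Fin (d + 1) → ℤ)} (hsub : Zc ⊆ Z₀c) (hsup : Z₀c ⊆ Zc) (Ac : (Fin (d + 1) → ℤ) → Fin (d + 1) → ℝ)
    (Λ : Finset (↥(fineDom L Zc) × ι)) (y y' : Λ) :
    cLam (hamR F e m2 (fineDom L Z₀c) Ac n) a (QkR F e hn (fineDom L Z₀c) Ac) s (((L : ℝ) ^ 2)⁻¹) w
        (nextAvg F (e / n) hL Z₀c n Ac) (Λ.map (embY hL hsub)) (lamEquiv hL hsub Λ y) (lamEquiv hL hsub Λ y')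
      = cLam (hamR F e m2 (fineDom L Zc) Ac n) a (QkR F e hn (fineDom L Zc) Ac) s (((L : ℝ) ^ 2)⁻¹) w
        (nextAvg F (e / n) hL Zc n Ac) Λ y y' := by
  obtain rfl : Zc = Z₀c := Finset.Subset.antisymm hsub hsup
  exact cLam_reindex _ _ _ _ _ _ _ Λ _ (lamEquiv hL hsub Λ) (fun _ => rfl) y y'

omit [Fintype ι] [DecidableEq ι] in
/-- `dist(y, Ω^{(k)}∖Λ) ≤ dist((y,i), (Ω^{(k)} × ι)∖(Λ × ι))` for a set `Λ ≠ Ω^{(k)}` of sites. [cite: Balaban1983RegularityDecay, (1.18) p.574, dictionary] -/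
theorem distCS_le_distCY [Fintype ι] {L : ℕ} {Zc : Finset (Fin (d + 1) → ℤ)} (Λs : Finset ↥(fineDom L Zc))
    (hΛ : ∃ s : ↥(fineDom L Zc), s ∉ Λs) (p : ↥(fineDom L Zc) × ι) :
    distCS Λs p.1 ≤ distCY (Λs ×ˢ (Finset.univ : Finset ι)) p := by
  obtain ⟨s, hs⟩ := hΛ
  unfold distCY
  refine le_csInf ⟨_, ⟨(s, p.2), fun h => hs (Finset.mem_product.1 h).1, rfl⟩⟩ ?_
  rintro _ ⟨z, hz, rfl⟩
  have hz1 : z.1 ∉ Λs := fun h => hz (Finset.mem_product.2 ⟨h, Finset.mem_univ _⟩)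
  exact distCS_le Λs p.1 hz1

omit [Fintype ι] [DecidableEq ι] in
/-- `Ω₀^{(k)} ⊆ Ω^{(k)}` forces `Ω₀^{(k+1)} ⊆ Ω^{(k+1)}` (labels of `L`-blocks). [cite: Balaban1983RegularityDecay, (1.19) p.574, dictionary] -/
theorem labels_sub_of_fineDom_sub {L : ℕ} (hL : 1 ≤ L) {Zc Z₀c : Finset (Fin (d + 1) → ℤ)}
    (h : fineDom L Z₀c ⊆ fineDom L Zc) : Z₀c ⊆ Zc := by
  intro z hz
  have hb := h (base_mem_fineDom hL Z₀c ⟨z, hz⟩)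
  rw [mem_fineDom hL, blk_mul hL] at hb
  exact hb

/-! ## §2. The family with a set `Λ` of sites and the literal complements -/

/-- ONE INSTANCE, LITERAL SHAPE: as `RegularRegionIdx` but with a set `Λ` OF SITES of `Ω^{(k)}` (the printed `Λ ⊂ Ω^{(k)}`).
[cite: Balaban1983RegularityDecay, (1.13)–(1.20) pp.573–574, dictionary] -/
structure RegularRegionIdxLit (d : ℕ) (L : ℕ) (m2max : ℝ) where
  n : ℕ
  hn : 1 ≤ n
  m2 : ℝ
  hm : 0 ≤ m2
  hm' : m2 ≤ m2max
  Zc : Finset (Fin (d + 1) → ℤ)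
  Z₀c : Finset (Fin (d + 1) → ℤ)
  hsub : Zc ⊆ Z₀c
  Λs : Finset ↥(fineDom L Zc)
  Ac : (Fin (d + 1) → ℤ) → Fin (d + 1) → ℝ
  e : ℝ

/-- the site–colour instance of a site instance: `Λ × {colours}`. [cite: Balaban1983RegularityDecay, (1.13) p.573, dictionary] -/
def litIdx {L : ℕ} {m2max : ℝ} (i : RegularRegionIdxLit d L m2max) : RegularRegionIdx d ι L m2max where
  n := i.n
  hn := i.hn
  m2 := i.m2
  hm := i.hm
  hm' := i.hm'
  Zc := i.Zc
  Z₀c := i.Z₀c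
  hsub := i.hsub
  Λ := i.Λs ×ˢ (Finset.univ : Finset ι)
  Ac := i.Ac
  e := i.e

/-- **THE REGULAR-FIELD NESTED-REGION CARRIERS WITH THE LITERAL COMPLEMENTS**: as `regularFieldRegions` at `Λ × {colours}`,
but `distLc x = dist_∞(x, Z^d ∖ Λ)` (`dCompl (Subtype.val '' ↑Λ)`) and `distOc x = dist_∞(x, Z^d ∖ Ω^{(k)})` (`dCompl ↑Ω^{(k)}`).
[cite: Balaban1983RegularityDecay, p. 574 Prop. 2.3 (1.18) («dist(x, Λ^c)»), (1.20) («dist(x, Ω^{(k)c})»), dictionary at a regular A] -/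
def regularFieldRegionsLit (F : OrthFlow ι) {L : ℕ} (hL : 1 ≤ L) (a a' c β m2max : ℝ)
    (i : RegularRegionIdxLit d L m2max) : B4.UnitSetting :=
  { regularFieldRegions F hL a a' c β m2max (litIdx (ι := ι) i) with
    distLc := fun y : ↥(i.Λs ×ˢ (Finset.univ : Finset ι)) => dCompl (Subtype.val '' (↑i.Λs : Set ↥(fineDom L i.Zc))) y.1.1.1
    distOc := fun y : ↥(i.Λs ×ˢ (Finset.univ : Finset ι)) => dCompl (↑(fineDom L i.Zc) : Set (Fin (d + 1) → ℤ)) y.1.1.1 }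

/-! ## §3. The leaf with the literal complements -/

section Leaf

variable (F : OrthFlow ι) {ℓ : ℝ} (hℓ : 0 ≤ ℓ)
  (hLip : ∀ t (v : ι → ℝ), ((F.U t - 1) *ᵥ v) ⬝ᵥ ((F.U t - 1) *ᵥ v) ≤ (ℓ * t) ^ 2 * (v ⬝ᵥ v))
  {L : ℕ} (hL : 1 ≤ L) {a : ℝ} (ha : 0 < a) {a' : ℝ} (ha' : 0 < a') {c : ℝ} (hc : 0 ≤ c) {β : ℝ} (hβ : 0 < β)
  (m2max : ℝ)

include hℓ hLip ha ha' hc hβ in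
/-- **LEAF WITH THE LITERAL COMPLEMENTS: «PROPOSITION 2.3 OF [1]» (1.15)–(1.20) ON THE REGULAR-FIELD FAMILY (`A ≠ 0`),
`Λ ⊂ Ω^{(k)}` A SET OF SITES, `Λ^c = Z^d ∖ Λ`, `Ω^{(k)c} = Z^d ∖ Ω^{(k)}`** — `B4.Prop23Printed (regularFieldRegionsLit F hL a_k
a′ c β m²₊)`, with the constants of `prop23Printed_regularRegions`.  (1.15), (1.16) as there; (1.18): for `Λ ≠ Ω^{(k)}` the
typed bound (weight `dist(·,(Ω^{(k)} × ι)∖(Λ × ι)) ≥ dist(·, Ω^{(k)}∖Λ) ≥ dist(·, Z^d∖Λ)`) implies the literal one, for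
`Λ = Ω^{(k)}` `δC^{(k)}_Λ(Ω,A) = 0` (`cLam_of_forall_mem`); (1.20): for `Ω ≠ Ω₀` via `dist(·, Ω₀^{(k)}∖Ω^{(k)}) ≥ dist(·,
Z^d∖Ω^{(k)})`, for `Ω = Ω₀` `δC^{(k)}_Λ(Ω,Ω₀,A) = 0` (`cLam_ambient_self`).
[cite: Balaban1983RegularityDecay, Prop. 2.3 of [1] (1.15)–(1.20) p.574, complements read in Z^d; §5 pp.593–594] -/
theorem prop23Printed_regularRegionsLit : B4.Prop23Printed (regularFieldRegionsLit (d := d) F hL a a' c β m2max) := by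
  obtain ⟨δ₀, c₀, γ₀, γ₁, e₁, hδ, hc₀, hγ₀, hγ₁, he₁, H⟩ :=
    prop23Printed_regularRegions (d := d) (ι := ι) F hℓ hLip hL ha ha' hc hβ m2max
  refine ⟨δ₀, c₀, γ₀, γ₁, e₁, hδ, hc₀, hγ₀, hγ₁, he₁, fun i hreg hbig he hle => ?_⟩
  obtain ⟨h15, h16, h18, h20⟩ := H (litIdx i) hreg hbig he hle
  refine ⟨h15, h16, fun y y' => ?_, fun y y' => ?_⟩
  · -- (1.17)–(1.18) with `Λ^c = Z^d ∖ Λ`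
    show |cLam (hamR F i.e i.m2 (fineDom L i.Zc) i.Ac i.n) a (QkR F i.e i.hn (fineDom L i.Zc) i.Ac) a' (((L : ℝ) ^ 2)⁻¹)
          (((L ^ (d + 1) : ℕ) : ℝ)) (nextAvg F (i.e / i.n) hL i.Zc i.n i.Ac) (i.Λs ×ˢ (Finset.univ : Finset ι)) y y'
        - (B4GaussRep36.deltaK (hamR F i.e i.m2 (fineDom L i.Zc) i.Ac i.n) a (QkR F i.e i.hn (fineDom L i.Zc) i.Ac)
          + (a' * ((L : ℝ) ^ 2)⁻¹) • pOp (((L ^ (d + 1) : ℕ) : ℝ)) (nextAvg F (i.e / i.n) hL i.Zc i.n i.Ac))⁻¹ y.1 y'.1|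
      ≤ c₀ * Real.exp (-(δ₀ * (rhoY L i.Zc y.1 y'.1 + dCompl (Subtype.val '' (↑i.Λs : Set ↥(fineDom L i.Zc))) y.1.1.1
        + dCompl (Subtype.val '' (↑i.Λs : Set ↥(fineDom L i.Zc))) y'.1.1.1)))
    by_cases hΛ : ∃ s : ↥(fineDom L i.Zc), s ∉ i.Λs
    · refine (h18 y y').trans (exp_bound_mono_weight hc₀.le hδ.le ?_)
      show _ ≤ rhoY L i.Zc y.1 y'.1 + distCY (i.Λs ×ˢ (Finset.univ : Finset ι)) y.1
        + distCY (i.Λs ×ˢ (Finset.univ : Finset ι)) y'.1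
      have h1 := (dCompl_le_distCS i.Λs hΛ y.1.1).trans (distCS_le_distCY i.Λs hΛ y.1)
      have h2 := (dCompl_le_distCS i.Λs hΛ y'.1.1).trans (distCS_le_distCY i.Λs hΛ y'.1)
      linarith
    · have hall : ∀ z : ↥(fineDom L i.Zc) × ι, z ∈ i.Λs ×ˢ (Finset.univ : Finset ι) := fun z =>
        Finset.mem_product.2 ⟨of_not_not fun hz => hΛ ⟨z.1, hz⟩, Finset.mem_univ _⟩
      rw [cLam_of_forall_mem _ _ _ _ _ _ _ _ hall, sub_self, abs_zero]
      exact mul_nonneg hc₀.le (Real.exp_pos _).le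
  · -- (1.19)–(1.20) with `Ω^{(k)c} = Z^d ∖ Ω^{(k)}`
    show |cLam (hamR F i.e i.m2 (fineDom L i.Zc) i.Ac i.n) a (QkR F i.e i.hn (fineDom L i.Zc) i.Ac) a' (((L : ℝ) ^ 2)⁻¹)
          (((L ^ (d + 1) : ℕ) : ℝ)) (nextAvg F (i.e / i.n) hL i.Zc i.n i.Ac) (i.Λs ×ˢ (Finset.univ : Finset ι)) y y'
        - cLam (hamR F i.e i.m2 (fineDom L i.Z₀c) i.Ac i.n) a (QkR F i.e i.hn (fineDom L i.Z₀c) i.Ac) a'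
          (((L : ℝ) ^ 2)⁻¹) (((L ^ (d + 1) : ℕ) : ℝ)) (nextAvg F (i.e / i.n) hL i.Z₀c i.n i.Ac)
          ((i.Λs ×ˢ (Finset.univ : Finset ι)).map (embY hL i.hsub))
          (lamEquiv hL i.hsub (i.Λs ×ˢ (Finset.univ : Finset ι)) y)
          (lamEquiv hL i.hsub (i.Λs ×ˢ (Finset.univ : Finset ι)) y')|
      ≤ c₀ * Real.exp (-(δ₀ * (rhoY L i.Zc y.1 y'.1 + dCompl (↑(fineDom L i.Zc) : Set (Fin (d + 1) → ℤ)) y.1.1.1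
        + dCompl (↑(fineDom L i.Zc) : Set (Fin (d + 1) → ℤ)) y'.1.1.1)))
    rcases Finset.eq_empty_or_nonempty (fineDom L i.Z₀c \ fineDom L i.Zc) with h0 | hne
    · rw [cLam_ambient_self F i.e i.hn hL a i.m2 a' _ i.hsub
        (labels_sub_of_fineDom_sub hL (Finset.sdiff_eq_empty_iff_subset.1 h0)) i.Ac, sub_self, abs_zero]
      exact mul_nonneg hc₀.le (Real.exp_pos _).le
    · refine (h20 y y').trans (exp_bound_mono_weight hc₀.le hδ.le ?_)
      show _ ≤ rhoY L i.Zc y.1 y'.1 + omegaY L i.Zc i.Z₀c y.1 + omegaY L i.Zc i.Z₀c y'.1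
      have h1 : dCompl (↑(fineDom L i.Zc) : Set (Fin (d + 1) → ℤ)) y.1.1.1 ≤ omegaY L i.Zc i.Z₀c y.1 :=
        dCompl_le_dSet hne y.1.1.1
      have h2 : dCompl (↑(fineDom L i.Zc) : Set (Fin (d + 1) → ℤ)) y'.1.1.1 ≤ omegaY L i.Zc i.Z₀c y'.1 :=
        dCompl_le_dSet hne y'.1.1.1
      linarith

end Leaf

/-- the literal-complement leaf for the ROTATION FLOW (`N = 2`, `ℓ = 1`): hypothesis-free flow instance.
[cite: Balaban1983RegularityDecay, Prop. 2.3 of [1] (1.15)–(1.20) p.574] -/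
theorem prop23Printed_regularRegionsLit_rot {L : ℕ} (hL : 1 ≤ L) {a : ℝ} (ha : 0 < a) {a' : ℝ} (ha' : 0 < a')
    {c : ℝ} (hc : 0 ≤ c) {β : ℝ} (hβ : 0 < β) (m2max : ℝ) :
    B4.Prop23Printed (regularFieldRegionsLit (d := d) OrthFlow.rot hL a a' c β m2max) :=
  prop23Printed_regularRegionsLit OrthFlow.rot zero_le_one rot_lipschitz hL ha ha' hc hβ m2max

/-- B1's original Prop. 2.3 (2.33)–(2.38) [Balaban1982Higgs1, pp. 611–612], intended reading, on the literal-complement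
family. [cite: Balaban1982Higgs1, Prop. 2.3 (2.33)–(2.38) pp.611–612] -/
theorem prop23Intended_regularRegionsLit (F : OrthFlow ι) {ℓ : ℝ} (hℓ : 0 ≤ ℓ)
    (hLip : ∀ t (v : ι → ℝ), ((F.U t - 1) *ᵥ v) ⬝ᵥ ((F.U t - 1) *ᵥ v) ≤ (ℓ * t) ^ 2 * (v ⬝ᵥ v))
    {L : ℕ} (hL : 1 ≤ L) {a : ℝ} (ha : 0 < a) {a' : ℝ} (ha' : 0 < a') {c : ℝ} (hc : 0 ≤ c) {β : ℝ} (hβ : 0 < β)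
    (m2max : ℝ) : B1.Prop23Intended (regularFieldRegionsLit (d := d) F hL a a' c β m2max) :=
  (B1.prop23Intended_iff_prop23Printed _).2 (prop23Printed_regularRegionsLit F hℓ hLip hL ha ha' hc hβ m2max)

/-! ## §4. The flow `U = e^{tq}` of (1.2) with ANY antisymmetric `q` (any `N`): hypothesis-free flow instances

r01's `B4Eq12ExpFlow.expFlow_lipschitz` discharges `hℓ`/`hLip` for the printed flow (1.2) `U(t) = e^{tq}`, `qᵀ = −q`
(`ℓ` = the Hilbert–Schmidt norm of `q`); the corollaries below are the `_exp` instances of the typed leaf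
`B4Prop23RegularFamily.prop23Printed_regularRegions` (file 5) and of the literal-complement leaf above, as requested by
the B4 owner (HOME/INBOX 2026-08-21T07:02:52Z). -/

/-- **«Proposition 2.3 of [1]» (1.15)–(1.20) on the regular-field family `regularFieldRegions`, for the flow `U = e^{tq}`
of (1.2) with ANY antisymmetric `q`** (any `N`): hypothesis-free in the flow.
[cite: Balaban1983RegularityDecay, Prop. 2.3 of [1] (1.15)–(1.20) p.574; (1.2) p.572; §5 pp.593–594] -/
theorem prop23Printed_regularRegions_exp (q : Matrix ι ι ℝ) (hq : qᵀ = -q) {L : ℕ} (hL : 1 ≤ L) {a : ℝ} (ha : 0 < a)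
    {a' : ℝ} (ha' : 0 < a') {c : ℝ} (hc : 0 ≤ c) {β : ℝ} (hβ : 0 < β) (m2max : ℝ) :
    B4.Prop23Printed (regularFieldRegions (d := d) (expFlow q hq) hL a a' c β m2max) :=
  prop23Printed_regularRegions (expFlow q hq) (expFlow_ell_nonneg q) (expFlow_lipschitz q hq) hL ha ha' hc hβ m2max

/-- B1's original Prop. 2.3 (2.33)–(2.38), intended reading, on `regularFieldRegions` for the flow `U = e^{tq}`, any
antisymmetric `q`. [cite: Balaban1982Higgs1, Prop. 2.3 (2.33)–(2.38) pp.611–612] -/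
theorem prop23Intended_regularRegions_exp (q : Matrix ι ι ℝ) (hq : qᵀ = -q) {L : ℕ} (hL : 1 ≤ L) {a : ℝ} (ha : 0 < a)
    {a' : ℝ} (ha' : 0 < a') {c : ℝ} (hc : 0 ≤ c) {β : ℝ} (hβ : 0 < β) (m2max : ℝ) :
    B1.Prop23Intended (regularFieldRegions (d := d) (expFlow q hq) hL a a' c β m2max) :=
  prop23Intended_regularRegions (expFlow q hq) (expFlow_ell_nonneg q) (expFlow_lipschitz q hq) hL ha ha' hc hβ m2max

/-- **the literal-complement leaf for the flow `U = e^{tq}` of (1.2) with ANY antisymmetric `q`** (any `N`).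
[cite: Balaban1983RegularityDecay, Prop. 2.3 of [1] (1.15)–(1.20) p.574, complements read in Z^d; (1.2) p.572] -/
theorem prop23Printed_regularRegionsLit_exp (q : Matrix ι ι ℝ) (hq : qᵀ = -q) {L : ℕ} (hL : 1 ≤ L) {a : ℝ} (ha : 0 < a)
    {a' : ℝ} (ha' : 0 < a') {c : ℝ} (hc : 0 ≤ c) {β : ℝ} (hβ : 0 < β) (m2max : ℝ) :
    B4.Prop23Printed (regularFieldRegionsLit (d := d) (expFlow q hq) hL a a' c β m2max) :=
  prop23Printed_regularRegionsLit (expFlow q hq) (expFlow_ell_nonneg q) (expFlow_lipschitz q hq) hL ha ha' hc hβ m2max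

/-- B1's original Prop. 2.3, intended reading, on the literal-complement family for the flow `U = e^{tq}`, any
antisymmetric `q`. [cite: Balaban1982Higgs1, Prop. 2.3 (2.33)–(2.38) pp.611–612] -/
theorem prop23Intended_regularRegionsLit_exp (q : Matrix ι ι ℝ) (hq : qᵀ = -q) {L : ℕ} (hL : 1 ≤ L) {a : ℝ} (ha : 0 < a)
    {a' : ℝ} (ha' : 0 < a') {c : ℝ} (hc : 0 ≤ c) {β : ℝ} (hβ : 0 < β) (m2max : ℝ) :
    B1.Prop23Intended (regularFieldRegionsLit (d := d) (expFlow q hq) hL a a' c β m2max) :=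
  prop23Intended_regularRegionsLit (expFlow q hq) (expFlow_ell_nonneg q) (expFlow_lipschitz q hq) hL ha ha' hc hβ m2max

end

end Literature.MathematicalPhysics.QuantumFieldTheory.Balaban1983to89.B4Prop23RegularFamilyLit
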